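import Summits.Schanuel.Schanuel.Theorems.RootDecomp1BMovingZeroFree02

/-!
# RootDecomp1BMovingZeroFree — lens 4, generation 42 «LEVEL-e SLOT BY PROOF» (RULE E-R21 (c) + B-R26 (a″); VERDICT L2187: THEOREM ×1 (B-g42)): the (1 | ρ) moving-zero storey HYPOTHESIS-FREE and one exponential order lower — `∀ ρ, LiouvilleOrder 7 ρ → 4 ≤ polarDeg (1, ρ)` and every (1|ρ) cell / member / 1K-link instance of FactDischarge01 + MovingZero02 §4 UNCONDITIONAL (record: order 8 mod hX) — the slot `ExpOneAlgApprox C` (an approximation measure for e with the degree binder n ≤ Y) filled BY PROOF from the Literature theorem NW96 Thm 4 (2), new separating member T₈ = towerNumber 8 — continuation (RootDecomp1BMovingZeroFree03): §3 cells hypothesis-free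

(lens-4 g42 HOME kernel MovingZeroFree.lean 1a475554…, 622 l, imports tree RootDecomp1BFactDischarge01 + Literature ExpOneTranscendenceMeasureProofs; CLAIM L2168, ACK/RULING/CHECKLIST B-g42 L2169, NODE L2183 / REQUEST L2184 / RESULT L2185, writer re-check L2186, critic VERDICT L2187 (CLEARED — THEOREM ×1 (B-g42); RULE B-R28; PORT GO 01–05 along K's § boundaries, `--supports stmt-Schanuel-24622`); port by census-1 gen 18 as `RootDecomp1BMovingZeroFree01`–`05`: 01 = §1 the slot `ExpOneAlgApprox` + its two suppliers (record hX, and BY PROOF from NW96 Thm 4(2)); 02 = §2 the budget and the engine one order lower (slot + `LiouvilleOrder 7` + moving zero ⟹ t ≥ 4); 03 = §3 the cells HYPOTHESIS-FREE; 04 = §4 members binder-free + the separating member `T₈ = towerNumber 8`; 05 = §5 the record recovered as an instance.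
PORT EDITS: the slot def's docstring tagged «[slot] definition with parameter; suppliers …» per the verdict (census convention); no `set_option` in K; three tree-twin helpers made `private` after the dedup bounce of 01 (p830609: `irreducible_map_rat_of_irreducible` ≡ Literature NW1996, `nesterenkoWaldschmidt1996_thm_4_2_inScope` ≡ `NesterenkoWaldschmidt1996_thm_4_2_holds`, `one_lt_log_sixteen` ≡ Literature Waldschmidt1978) with per-part private copies; likewise `log_le_log_add_div_sub_one` (≡ Literature Fourier SlitStrip, bounce p830636) and `one_le_log_add_one`; and `four_le_polarDeg_one_ultra` (§3 read-back ≡ tree `RootDecomp1BFactDischarge.four_le_polarDeg_one_ultra`, bounce p830998); statements and proofs verbatim. `--supports stmt-Schanuel-24622`; no census credit carried; rung 0 — nothing here proves Schanuel.)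
-/

noncomputable section

open Complex Polynomial

namespace Summit.Schanuel.Schanuel.Theorems.RootDecomp1BMovingZeroFree

open Summit.Schanuel.Schanuel.Theorems.RootDecomp1KHyper (LWMeasure)
open Summit.Schanuel.Schanuel.Theorems.RootDecomp1KHyper.HyperCell (log_sixteen_lt_three HyperLiouville lambdaH
  hyperLiouville_lambdaH ExplicitRatExpApprox C₀rat)
open Summit.Schanuel.Schanuel.Theorems.RootDecomp1KGeneric (LiouvilleOrder)
open Summit.Schanuel.Schanuel.Theorems.RootDecomp1KFiniteOrderCell (towerNumber liouvilleOrder_towerNumber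
  not_hyperLiouville_towerNumber towerNumber_sub_rat_lower liouville_towerNumber not_liouvilleOrder_towerNumber)
open Summit.Schanuel.Schanuel.Theorems.RootDecomp1BFedFlagCore (polarDeg polarField)
open Summit.Schanuel.Schanuel.Theorems.RootDecomp1BDefectFloorDefs (SharpRelativeLindemannAt TameDefectZeroAt
  WildSharpDefectZeroAt WildSharpDefectZeroInitAt)
open Summit.Schanuel.Schanuel.Theorems.RootDecomp1BRadicalDescent (UltraLiouville linearIndependent_one_of_irrational)
open Summit.Schanuel.Schanuel.Theorems.RootDecomp1BMovingZero (triple MovingZeroApprox algebraicIndependent_triple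
  isAlgebraic_pair_of_lt_four mem_polarField_one mem_polarField_swap factor_le four_le_polarDeg_of_movingZero
  liouvilleOrder_rhoT not_hyperLiouville_rhoT not_ultraLiouville_rhoT)
open Summit.Schanuel.Schanuel.Theorems.RootDecomp1BFactDischarge (lwMeasure_holds movingZeroApprox_holds)
open Literature.NumberTheory.Transcendental (NesterenkoWaldschmidt1996_thm_4_2 NesterenkoWaldschmidt1996_thm_4_2_holds)
open Literature.NumberTheory.Transcendental.NW1996 (approx_measure_exp_one)

/-! ## §3  The cells — HYPOTHESIS-FREE -/

section Cells

/-- **THE KERNEL, FREE (general polar field):** for EVERY real `ρ` of exponential Liouville order `7`, every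
real tuple `r` whose polar field contains `ρ, e, e^i, e^ρ, e^{iρ}` has `t(r) ≥ 4`.  NO fact binder:
`LWMeasure` := `lwMeasure_holds`, the slot := `expOneAlgApprox_holds`, the piece := `movingZeroApprox_holds ρ`. -/
theorem four_le_polarDeg_of_liouvilleOrder_seven {ρ : ℝ} (hρ : LiouvilleOrder 7 ρ) {m : ℕ} {r : Fin m → ℝ}
    (hρr : (ρ : ℂ) ∈ polarField r) (he : cexp 1 ∈ polarField r) (hei : cexp Complex.I ∈ polarField r)
    (heρ : cexp ρ ∈ polarField r) (heρi : cexp (ρ * Complex.I) ∈ polarField r) :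
    ((2 + 2 : ℕ) : Cardinal) ≤ polarDeg r :=
  four_le_polarDeg_of_slot lwMeasure_holds (by norm_num) expOneAlgApprox_holds hρ (movingZeroApprox_holds ρ)
    hρr he hei heρ heρi

/-- **X(2)(1, ρ), FREE:** `t(1, ρ) ≥ 4` for EVERY real `ρ` of exponential Liouville order `7` — UNCONDITIONAL. -/
theorem four_le_polarDeg_one_of_liouvilleOrder_seven {ρ : ℝ} (hρ : LiouvilleOrder 7 ρ) :
    ((2 + 2 : ℕ) : Cardinal) ≤ polarDeg ![(1 : ℝ), ρ] := by
  obtain ⟨h₁, h₂, h₃, h₄, h₅⟩ := mem_polarField_one ρ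
  exact four_le_polarDeg_of_liouvilleOrder_seven hρ h₁ h₂ h₃ h₄ h₅

/-- The swapped ordering `(ρ, 1)` — DERIVED (same polar field), FREE. -/
theorem four_le_polarDeg_swap_of_liouvilleOrder_seven {ρ : ℝ} (hρ : LiouvilleOrder 7 ρ) :
    ((2 + 2 : ℕ) : Cardinal) ≤ polarDeg ![ρ, (1 : ℝ)] := by
  obtain ⟨h₁, h₂, h₃, h₄, h₅⟩ := mem_polarField_swap ρ
  exact four_le_polarDeg_of_liouvilleOrder_seven hρ h₁ h₂ h₃ h₄ h₅

/-- … and every higher order (monotonicity), FREE. -/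
theorem four_le_polarDeg_one_of_order_ge {ρ : ℝ} {k : ℕ} (hk : 7 ≤ k) (hρ : LiouvilleOrder k ρ) :
    ((2 + 2 : ℕ) : Cardinal) ≤ polarDeg ![(1 : ℝ), ρ] :=
  four_le_polarDeg_one_of_liouvilleOrder_seven (hρ.mono hk)

/-- **THE RECORD'S NAME WITHOUT ITS BINDER:** `t(1, ρ) ≥ 4` for every real `ρ` of exponential order `8`
(tree `RootDecomp1BFactDischarge.four_le_polarDeg_one_of_liouvilleOrder_eight (hX)`, now `hX`-FREE). -/
theorem four_le_polarDeg_one_of_liouvilleOrder_eight {ρ : ℝ} (hρ : LiouvilleOrder 8 ρ) :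
    ((2 + 2 : ℕ) : Cardinal) ≤ polarDeg ![(1 : ℝ), ρ] :=
  four_le_polarDeg_one_of_order_ge (by norm_num) hρ

/-- … the swapped record cell, `hX`-FREE. -/
theorem four_le_polarDeg_swap_of_liouvilleOrder_eight {ρ : ℝ} (hρ : LiouvilleOrder 8 ρ) :
    ((2 + 2 : ℕ) : Cardinal) ≤ polarDeg ![ρ, (1 : ℝ)] :=
  four_le_polarDeg_swap_of_liouvilleOrder_seven (hρ.mono (by norm_num))

/-- **X(2)(1, ρ), hyper-Liouville `ρ`** (the class of 1K's item 33363) — FREE. -/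
theorem four_le_polarDeg_one_hyper {ρ : ℝ} (hρ : HyperLiouville ρ) :
    ((2 + 2 : ℕ) : Cardinal) ≤ polarDeg ![(1 : ℝ), ρ] :=
  four_le_polarDeg_one_of_liouvilleOrder_seven (LiouvilleOrder.of_hyperLiouville hρ 7)

/-- **X(2)(1, ρ), ultra-Liouville `ρ`** — FREE (the tree decides this class independently, by radical
descent; recorded to show the order-7 class COVERS it). -/
private theorem four_le_polarDeg_one_ultra {ρ : ℝ} (hρ : UltraLiouville ρ) :
    ((2 + 2 : ℕ) : Cardinal) ≤ polarDeg ![(1 : ℝ), ρ] :=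
  four_le_polarDeg_one_hyper hρ.hyperLiouville

/-- The same in the VERBATIM shape of the body of the 1B crux `KleinPolarSchanuel` (item 24622) at `m = 2`,
`r = (1, ρ)` (`polarDeg` unfolded) — FREE, for every `ρ` of exponential order `7`. -/
theorem kleinPolarSchanuel_body_two_one {ρ : ℝ} (hρ : LiouvilleOrder 7 ρ) :
    ((2 + 2 : ℕ) : Cardinal) ≤ Algebra.trdeg ℚ ↥(IntermediateField.adjoin ℚ
      (Set.range (Fin.append (fun j => ((![(1 : ℝ), ρ] j : ℝ) : ℂ)) (fun j => ((![(1 : ℝ), ρ] j : ℝ) : ℂ) * Complex.I)) ∪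
        Set.range (Complex.exp ∘ Fin.append (fun j => ((![(1 : ℝ), ρ] j : ℝ) : ℂ))
          (fun j => ((![(1 : ℝ), ρ] j : ℝ) : ℂ) * Complex.I)))) :=
  four_le_polarDeg_one_of_liouvilleOrder_seven hρ

/-- `t(1, ρ) ≥ 3` (the weaker floor, for the SRL step instance) — FREE. -/
theorem three_le_polarDeg_one {ρ : ℝ} (hρ : LiouvilleOrder 7 ρ) :
    ((1 + 1 + 1 : ℕ) : Cardinal) ≤ polarDeg ![(1 : ℝ), ρ] :=
  (Nat.cast_le.2 (by norm_num)).trans (four_le_polarDeg_one_of_liouvilleOrder_seven hρ)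

/-- **SRLAt (1 | ρ)** — the sharp relative Lindemann step of item 32406 AT `(1 | ρ)` — FREE. -/
theorem sharpRelativeLindemannAt_one {ρ : ℝ} (hρ : LiouvilleOrder 7 ρ) : SharpRelativeLindemannAt 1 ![(1 : ℝ), ρ] :=
  fun _ _ _ => three_le_polarDeg_one hρ

/-- **T0At (1 | ρ)** — the tame defect-zero step of item 32407 AT `(1 | ρ)` — FREE. -/
theorem tameDefectZeroAt_one {ρ : ℝ} (hρ : LiouvilleOrder 7 ρ) : TameDefectZeroAt 1 ![(1 : ℝ), ρ] :=
  fun _ _ _ _ => four_le_polarDeg_one_of_liouvilleOrder_seven hρ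

/-- **W0At (1 | ρ)** — the wild sharp defect-zero step of item 32408 AT `(1 | ρ)` — FREE. -/
theorem wildSharpDefectZeroAt_one {ρ : ℝ} (hρ : LiouvilleOrder 7 ρ) : WildSharpDefectZeroAt 1 ![(1 : ℝ), ρ] :=
  fun _ _ _ _ _ => four_le_polarDeg_one_of_liouvilleOrder_seven hρ

/-- **W0InitAt (1 | ρ)** — the init-form of the wild step AT `(1 | ρ)` — FREE. -/
theorem wildSharpDefectZeroInitAt_one {ρ : ℝ} (hρ : LiouvilleOrder 7 ρ) : WildSharpDefectZeroInitAt 1 ![(1 : ℝ), ρ] :=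
  fun _ _ _ _ _ => four_le_polarDeg_one_of_liouvilleOrder_seven hρ

/-- LIVE LINK (route 1K, item 33363 `HyperLiouvilleSchanuel`): its `n = 4` instance at `z = (1, ρ, i, iρ)` in the
item's verbatim binder shape, `ρ` hyper-Liouville — FREE (both binders unused: the cell holds outright). -/
theorem hyperLiouvilleSchanuel_instance_one {ρ : ℝ} (hρ : HyperLiouville ρ) :
    LinearIndependent ℚ (Fin.append (fun j => ((![(1 : ℝ), ρ] j : ℝ) : ℂ))
        (fun j => ((![(1 : ℝ), ρ] j : ℝ) : ℂ) * Complex.I)) →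
      (∀ m : ℕ, ∃ h : Fin (2 + 2) → ℤ, h ≠ 0 ∧
        ‖∑ i, (h i : ℂ) * (Fin.append (fun j => ((![(1 : ℝ), ρ] j : ℝ) : ℂ))
          (fun j => ((![(1 : ℝ), ρ] j : ℝ) : ℂ) * Complex.I)) i‖ < Real.exp (-((1 + ∑ i, (|h i| : ℝ)) ^ m))) →
      ((2 + 2 : ℕ) : Cardinal) ≤ Algebra.trdeg ℚ ↥(IntermediateField.adjoin ℚ
        (Set.range (Fin.append (fun j => ((![(1 : ℝ), ρ] j : ℝ) : ℂ)) (fun j => ((![(1 : ℝ), ρ] j : ℝ) : ℂ) * Complex.I)) ∪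
          Set.range (Complex.exp ∘ Fin.append (fun j => ((![(1 : ℝ), ρ] j : ℝ) : ℂ))
            (fun j => ((![(1 : ℝ), ρ] j : ℝ) : ℂ) * Complex.I)))) :=
  fun _ _ => four_le_polarDeg_one_hyper hρ

/-- LIVE LINK (route 1K, item 33364 `FiniteOrderLiouvilleSchanuel`): its `n = 4` instance at `z = (1, ρ, i, iρ)`,
`ρ` of exponential order `7` (hyper or NOT) — FREE. -/
theorem finiteOrderLiouvilleSchanuel_instance_one {ρ : ℝ} (hρ : LiouvilleOrder 7 ρ) :
    LinearIndependent ℚ (Fin.append (fun j => ((![(1 : ℝ), ρ] j : ℝ) : ℂ))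
        (fun j => ((![(1 : ℝ), ρ] j : ℝ) : ℂ) * Complex.I)) →
      (∀ ω : ℕ, ∃ h : Fin (2 + 2) → ℤ, h ≠ 0 ∧
        ‖∑ i, (h i : ℂ) * (Fin.append (fun j => ((![(1 : ℝ), ρ] j : ℝ) : ℂ))
          (fun j => ((![(1 : ℝ), ρ] j : ℝ) : ℂ) * Complex.I)) i‖ <
            1 / (1 + ∑ i, (|h i| : ℝ)) ^ ω) →
      (¬ ∀ m : ℕ, ∃ h : Fin (2 + 2) → ℤ, h ≠ 0 ∧
        ‖∑ i, (h i : ℂ) * (Fin.append (fun j => ((![(1 : ℝ), ρ] j : ℝ) : ℂ))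
          (fun j => ((![(1 : ℝ), ρ] j : ℝ) : ℂ) * Complex.I)) i‖ <
            Real.exp (-((1 + ∑ i, (|h i| : ℝ)) ^ m))) →
      ((2 + 2 : ℕ) : Cardinal) ≤ Algebra.trdeg ℚ ↥(IntermediateField.adjoin ℚ
        (Set.range (Fin.append (fun j => ((![(1 : ℝ), ρ] j : ℝ) : ℂ))
            (fun j => ((![(1 : ℝ), ρ] j : ℝ) : ℂ) * Complex.I)) ∪
          Set.range (Complex.exp ∘ Fin.append (fun j => ((![(1 : ℝ), ρ] j : ℝ) : ℂ))
            (fun j => ((![(1 : ℝ), ρ] j : ℝ) : ℂ) * Complex.I)))) :=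
  fun _ _ _ => four_le_polarDeg_one_of_liouvilleOrder_seven hρ

/-- … and in the RECORD's binder shape (item 33364 instance at exponential order `8`, tree
`RootDecomp1BMovingZero.finiteOrderLiouvilleSchanuel_instance_one (hLW) (hX) (hρ) (hMZ)`) — FREE. -/
theorem finiteOrderLiouvilleSchanuel_instance_one_eight {ρ : ℝ} (hρ : LiouvilleOrder 8 ρ) :
    LinearIndependent ℚ (Fin.append (fun j => ((![(1 : ℝ), ρ] j : ℝ) : ℂ))
        (fun j => ((![(1 : ℝ), ρ] j : ℝ) : ℂ) * Complex.I)) →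
      (∀ ω : ℕ, ∃ h : Fin (2 + 2) → ℤ, h ≠ 0 ∧
        ‖∑ i, (h i : ℂ) * (Fin.append (fun j => ((![(1 : ℝ), ρ] j : ℝ) : ℂ))
          (fun j => ((![(1 : ℝ), ρ] j : ℝ) : ℂ) * Complex.I)) i‖ <
            1 / (1 + ∑ i, (|h i| : ℝ)) ^ ω) →
      (¬ ∀ m : ℕ, ∃ h : Fin (2 + 2) → ℤ, h ≠ 0 ∧
        ‖∑ i, (h i : ℂ) * (Fin.append (fun j => ((![(1 : ℝ), ρ] j : ℝ) : ℂ))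
          (fun j => ((![(1 : ℝ), ρ] j : ℝ) : ℂ) * Complex.I)) i‖ <
            Real.exp (-((1 + ∑ i, (|h i| : ℝ)) ^ m))) →
      ((2 + 2 : ℕ) : Cardinal) ≤ Algebra.trdeg ℚ ↥(IntermediateField.adjoin ℚ
        (Set.range (Fin.append (fun j => ((![(1 : ℝ), ρ] j : ℝ) : ℂ))
            (fun j => ((![(1 : ℝ), ρ] j : ℝ) : ℂ) * Complex.I)) ∪
          Set.range (Complex.exp ∘ Fin.append (fun j => ((![(1 : ℝ), ρ] j : ℝ) : ℂ))
            (fun j => ((![(1 : ℝ), ρ] j : ℝ) : ℂ) * Complex.I)))) :=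
  finiteOrderLiouvilleSchanuel_instance_one (hρ.mono (by norm_num))

end Cells

end Summit.Schanuel.Schanuel.Theorems.RootDecomp1BMovingZeroFree

end
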